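import Literature.AlgebraicGeometry.Frobenioids.ArchimedeanFrobenioids
import Literature.AlgebraicGeometry.Frobenioids.ArchimedeanCircleGeometry
import Literature.AlgebraicGeometry.Frobenioids.AngularRegionTensor
import HarnessLib

/-!
# Frobenioids II, Example 3.3 (i): the calculus of angular regions read inside `ℂ^×`

Mochizuki, *The geometry of Frobenioids II: poly-Frobenioids*, Kyushu J. Math. **62** (2008)
401–460, §3, Definition 3.1 (ii)–(iv) and Example 3.3 (i), author's text pp. 23–24, 27–28
[cite: MochizukiFrdII2008, Ex 3.3 (i) p.27].  PROOF-ONLY infrastructure file (no definition) for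
the discharge of "`C` is a Frobenioid" (Ex. 3.3 (ii)): the polar calculus `u = (u/|u|) · |u|` of
abc-iut-L1-t4's `ArchimedeanData.lean` (`unitPart`, `absHom`, `ofPosReal`, `AngularRegion.carrier`)
and of abc-iut-L1-t6's `C₀` (`ArchimedeanFrobenioids.lean`: `pullRegion`, the datum (c) of a
morphism "an isomorphism `V_L^{⊗d} ⥲ V_K|_L` that maps `A_L^{⊗d}` into `A_K|_L`").

Main statements (all PROVED): the `d`-fold product `A^{⊗d}` of an angular region
`A = B × (0, λ]` is `B^d × (0, λ^d]` (`mem_carrier_pow_iff`); THE CRITERION for datum (c):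
`c · A^{⊗d} ⊆ A'` iff `(c/|c|) · B^d ⊆ B'` and `|c| λ^d ≤ λ'` (`smul_carrier_pow_subset_iff`); the
base change `A_K|_L` along an arrow `f` of `D₀` is again an angular region, with the same tip and
with angular part the Galois twist of `B` (`exists_pulledRegion`); and every pair
(connected open `B`, tip) underlies an object of `C₀` over a prescribed base (`exists_obj`).
-/

namespace Literature.AlgebraicGeometry.Frobenioids

open Set Function Topology
open scoped Pointwise

noncomputable section

namespace ArchFrd

/-! ### Polar coordinates on `K^×` (Def. 3.1 (ii)) -/

section Polar

variable {K : Type*} [RCLike K]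

/-- `|z| = 1` for `z ∈ O_K^×`, in `ℝ_{>0}`. [cite: MochizukiFrdII2008, Def 3.1 (ii) p.23] -/
theorem absHom_coe_normOne (z : normOneSubgroup K) : absHom K (z : Kˣ) = 1 := by
  rw [← MonoidHom.mem_ker, ker_absHom]; exact z.2

/-- `z/|z| = z` for `z ∈ O_K^×`. [cite: MochizukiFrdII2008, Def 3.1 (ii) p.23] -/
theorem unitPart_normOne_coe (z : normOneSubgroup K) : unitPart K (z : Kˣ) = z := by
  have := (unitPart_absHom_polar z 1).1
  rwa [map_one, mul_one] at this

/-- A positive real has trivial unit part. [cite: MochizukiFrdII2008, Def 3.1 (ii) p.23] -/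
theorem unitPart_ofPosReal (x : PosReal) : unitPart K (ofPosReal K x) = 1 := by
  have := (unitPart_absHom_polar (1 : normOneSubgroup K) x).1
  rwa [OneMemClass.coe_one, one_mul] at this

/-- `1/|1| = 1`. [cite: MochizukiFrdII2008, Def 3.1 (ii) p.23] -/
theorem unitPart_one : unitPart K (1 : Kˣ) = 1 := by
  rw [← map_one (ofPosReal K), unitPart_ofPosReal]

/-- `u ↦ u/|u|` commutes with inverses. [cite: MochizukiFrdII2008, Def 3.1 (ii) p.23] -/
theorem unitPart_inv (u : Kˣ) : unitPart K u⁻¹ = (unitPart K u)⁻¹ :=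
  eq_inv_of_mul_eq_one_left (by
    rw [← unitPart_mul, inv_mul_cancel, ← map_one (ofPosReal K), unitPart_ofPosReal])

/-- `|u| ≤ λ` in `ℝ_{>0}` iff `‖u‖ ≤ λ` in `ℝ`. [cite: MochizukiFrdII2008, Def 3.1 (ii) p.23] -/
theorem absHom_le_iff (u : Kˣ) (t : PosReal) : absHom K u ≤ t ↔ ‖(u : K)‖ ≤ (t : ℝ) := by
  rw [← Subtype.coe_le_coe, coe_absHom]

end Polar

/-! ### Membership in angular regions and their products (Def. 3.1 (iii), `A^{⊗d}`) -/

namespace AngularRegion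

variable {K : Type*} [RCLike K] (A : AngularRegion K)

/-- Membership in `A = B × (0, λ]`: unit part in `B`, absolute value `≤ λ` (the definition).
[cite: MochizukiFrdII2008, Def 3.1 (iii) p.24] -/
theorem mem_carrier_polar_iff (u : Kˣ) : u ∈ A.carrier ↔ unitPart K u ∈ A.dir ∧ absHom K u ≤ A.tip :=
  Iff.rfl

/-- The point of `A` with polar coordinates `(z, x)`. [cite: MochizukiFrdII2008, Def 3.1 (iii) p.24] -/
theorem coe_mul_ofPosReal_mem_carrier_iff (z : normOneSubgroup K) (x : PosReal) :
    (z : Kˣ) * ofPosReal K x ∈ A.carrier ↔ z ∈ A.dir ∧ x ≤ A.tip := by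
  rw [mem_carrier_polar_iff, (unitPart_absHom_polar z x).1, (unitPart_absHom_polar z x).2]

/-- `B ≠ ∅` (Def. 3.1 (iii): "[nonempty and]"). [cite: MochizukiFrdII2008, Def 3.1 (iii) p.24] -/
theorem dir_nonempty : A.dir.Nonempty := by
  obtain ⟨z, hz, -⟩ := (A.isConnected_inter 1).nonempty
  exact ⟨z, hz⟩

/-- The angular part of `A` is the set of unit parts of its points.
[cite: MochizukiFrdII2008, Def 3.1 (iii) p.24] -/
theorem image_unitPart_carrier : unitPart K '' A.carrier = A.dir := by
  refine Subset.antisymm ?_ fun z hz => ?_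
  · rintro _ ⟨u, hu, rfl⟩
    exact hu.1
  · exact ⟨(z : Kˣ) * ofPosReal K A.tip, (A.coe_mul_ofPosReal_mem_carrier_iff z A.tip).2 ⟨hz, le_rfl⟩,
      (unitPart_absHom_polar z A.tip).1⟩

/-- **The product region `A^{⊗d}`** (Def. 3.1 (iii), last sentence; Ex. 3.3 (i) (c)): for `d ≥ 1`,
`u ∈ A^d` iff `u/|u| ∈ B^d` and `|u| ≤ λ^d`. [cite: MochizukiFrdII2008, Def 3.1 (iii) p.24] -/
theorem mem_carrier_pow_iff : ∀ (n : ℕ) (u : Kˣ),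
    u ∈ A.carrier ^ (n + 1) ↔ unitPart K u ∈ A.dir ^ (n + 1) ∧ absHom K u ≤ A.tip ^ (n + 1)
  | 0, u => by rw [zero_add, pow_one, pow_one, pow_one]; exact A.mem_carrier_polar_iff u
  | n + 1, u => by
    rw [pow_succ, pow_succ A.dir, pow_succ A.tip, Set.mem_mul]
    constructor
    · rintro ⟨v, hv, w, hw, rfl⟩
      rw [mem_carrier_pow_iff n] at hv
      rw [unitPart_mul, map_mul]
      exact ⟨Set.mul_mem_mul hv.1 hw.1, mul_le_mul' hv.2 hw.2⟩
    · rintro ⟨hdir, habs⟩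
      obtain ⟨b', hb', b, hb, hprod⟩ := Set.mem_mul.mp hdir
      -- split `u = v · w` with `|w| = λ`, `|v| = |u| / λ`
      refine ⟨(b' : Kˣ) * ofPosReal K (absHom K u * A.tip⁻¹), ?_, (b : Kˣ) * ofPosReal K A.tip,
        (A.coe_mul_ofPosReal_mem_carrier_iff b A.tip).2 ⟨hb, le_rfl⟩, ?_⟩
      · rw [mem_carrier_pow_iff n, (unitPart_absHom_polar _ _).1,
          (unitPart_absHom_polar _ _).2]
        refine ⟨hb', ?_⟩
        calc absHom K u * A.tip⁻¹ ≤ A.tip ^ (n + 1) * A.tip * A.tip⁻¹ := mul_le_mul' habs le_rfl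
          _ = A.tip ^ (n + 1) := mul_inv_cancel_right _ _
      · rw [mul_mul_mul_comm, ← map_mul, ← Subgroup.coe_mul, hprod, inv_mul_cancel_right]
        exact unitPart_mul_ofPosReal_absHom u

/-- The angular part of `c · A^{⊗d}` is `(c/|c|) · B^d` (`d ≥ 1`).
[cite: MochizukiFrdII2008, Ex 3.3 (i) p.28] -/
theorem image_unitPart_smul_carrier_pow (c : Kˣ) (n : ℕ) :
    unitPart K '' (c • A.carrier ^ (n + 1)) = unitPart K c • A.dir ^ (n + 1) := by
  refine Subset.antisymm ?_ ?_
  · rintro _ ⟨_, ⟨v, hv, rfl⟩, rfl⟩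
    change unitPart K (c * v) ∈ _
    rw [unitPart_mul]
    exact Set.smul_mem_smul_set ((A.mem_carrier_pow_iff n v).1 hv).1
  · rintro _ ⟨b, hb, rfl⟩
    refine ⟨c * ((b : Kˣ) * ofPosReal K (A.tip ^ (n + 1))), Set.smul_mem_smul_set ?_, ?_⟩
    · rw [A.mem_carrier_pow_iff n, (unitPart_absHom_polar _ _).1,
        (unitPart_absHom_polar _ _).2]
      exact ⟨hb, le_rfl⟩
    · rw [unitPart_mul, (unitPart_absHom_polar _ _).1]; rfl

/-- **The criterion for datum (c) of a morphism of `C₀`** ("an isomorphism `V_L^{⊗d} ⥲ V_K|_L` that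
maps `A_L^{⊗d}` into `A_K|_L`", Ex. 3.3 (i) (c), with `V = K` and the isomorphism = multiplication by
`c`): `c · A^{⊗d} ⊆ A'` iff `(c/|c|) · B^d ⊆ B'` and `|c| · λ^d ≤ λ'` (`d ≥ 1`).
[cite: MochizukiFrdII2008, Ex 3.3 (i) p.27] -/
theorem smul_carrier_pow_subset_iff (A' : AngularRegion K) (c : Kˣ) (n : ℕ) :
    c • A.carrier ^ (n + 1) ⊆ A'.carrier ↔
      unitPart K c • A.dir ^ (n + 1) ⊆ A'.dir ∧ absHom K c * A.tip ^ (n + 1) ≤ A'.tip := by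
  constructor
  · intro h
    constructor
    · rw [← A.image_unitPart_smul_carrier_pow c n, ← A'.image_unitPart_carrier]
      exact Set.image_mono h
    · obtain ⟨b, hb⟩ : (A.dir ^ (n + 1)).Nonempty := A.dir_nonempty.pow
      have hmem : c * ((b : Kˣ) * ofPosReal K (A.tip ^ (n + 1))) ∈ A'.carrier := by
        refine h (Set.smul_mem_smul_set ?_)
        rw [A.mem_carrier_pow_iff n, (unitPart_absHom_polar _ _).1,
          (unitPart_absHom_polar _ _).2]
        exact ⟨hb, le_rfl⟩
      have := ((A'.mem_carrier_polar_iff _).1 hmem).2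
      rwa [map_mul, (unitPart_absHom_polar _ _).2] at this
  · rintro ⟨hdir, habs⟩ _ ⟨v, hv, rfl⟩
    obtain ⟨hv₁, hv₂⟩ := (A.mem_carrier_pow_iff n v).1 hv
    change c * v ∈ A'.carrier
    refine (A'.mem_carrier_polar_iff _).2 ⟨?_, ?_⟩
    · rw [unitPart_mul]
      exact hdir (Set.smul_mem_smul_set hv₁)
    · rw [map_mul]
      exact (mul_le_mul' le_rfl hv₂).trans habs

/-- The tip condition of the criterion, in `ℝ`: `|c| λ^d ≤ λ'`.
[cite: MochizukiFrdII2008, Ex 3.3 (i) p.28] -/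
theorem absHom_mul_pow_le_iff (A' : AngularRegion K) (c : Kˣ) (n : ℕ) :
    absHom K c * A.tip ^ n ≤ A'.tip ↔ ‖(c : K)‖ * (A.tip : ℝ) ^ n ≤ (A'.tip : ℝ) := by
  rw [← Subtype.coe_le_coe, Positive.val_mul, Positive.val_pow, coe_absHom]

end AngularRegion

/-! ### The Galois twist on `ℂ^×` in polar coordinates; base change of regions (Def. 3.1 (iv)) -/

/-- Complex conjugation inverts the unit part: `conj(u)/|conj(u)| = (u/|u|)⁻¹`.
[cite: MochizukiFrdII2008, Def 3.1 (iv) p.24] -/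
theorem unitPart_galAct_true (u : ℂˣ) : unitPart ℂ (D0.galAct true u) = (unitPart ℂ u)⁻¹ := by
  have hu := unitPart_mul_ofPosReal_absHom u
  have h1 : star (ofPosReal ℂ (absHom ℂ u)) = ofPosReal ℂ (absHom ℂ u) := by
    apply Units.ext
    rw [Units.coe_star, ← starRingEnd_apply, coe_ofPosReal, RCLike.conj_ofReal]
  have h2 : star ((unitPart ℂ u : ℂˣ)) = (((unitPart ℂ u)⁻¹ : normOneSubgroup ℂ) : ℂˣ) := by
    apply Units.ext
    rw [Units.coe_star, ← starRingEnd_apply, Subgroup.coe_inv, Units.val_inv_eq_inv_val,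
      Complex.inv_eq_conj ((mem_normOneSubgroup_iff ℂ _).1 (unitPart ℂ u).2)]
  calc unitPart ℂ (D0.galAct true u)
      = unitPart ℂ (star ((unitPart ℂ u : ℂˣ) * ofPosReal ℂ (absHom ℂ u))) := by
        rw [hu, D0.galAct_true]
    _ = unitPart ℂ ((((unitPart ℂ u)⁻¹ : normOneSubgroup ℂ) : ℂˣ) * ofPosReal ℂ (absHom ℂ u)) := by
        rw [star_mul', h1, h2]
    _ = (unitPart ℂ u)⁻¹ := (unitPart_absHom_polar _ _).1

/-- The unit part of a Galois twist of a point of `O_ℂ^×` read back in `O_ℂ^×`: the identity or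
inversion. [cite: MochizukiFrdII2008, Def 3.1 (iv) p.24] -/
theorem unitPart_galAct_coe (σ : Bool) (z : normOneSubgroup ℂ) :
    unitPart ℂ (D0.galAct σ (z : ℂˣ)) = bif σ then z⁻¹ else z := by
  cases σ
  · rw [D0.galAct_false]; exact unitPart_normOne_coe z
  · rw [unitPart_galAct_true, unitPart_normOne_coe]; rfl

/-- The unit part of a twisted product `σ(c · z)`, `z ∈ O_ℂ^×`.
[cite: MochizukiFrdII2008, Def 3.1 (iv) p.24] -/
theorem unitPart_galAct_mul (σ : Bool) (c : ℂˣ) (z : normOneSubgroup ℂ) :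
    unitPart ℂ (D0.galAct σ (c * (z : ℂˣ))) =
      unitPart ℂ (D0.galAct σ c) * unitPart ℂ (D0.galAct σ (z : ℂˣ)) := by
  rw [map_mul, unitPart_mul]

/-- Membership in a Galois twist of a region: `u ∈ σ(A)` iff `σ(u) ∈ A` (`σ` is an involution).
[cite: MochizukiFrdII2008, Def 3.1 (iv) p.24] -/
theorem mem_image_galAct_iff (σ : Bool) (S : Set ℂˣ) (u : ℂˣ) :
    u ∈ D0.galAct σ '' S ↔ D0.galAct σ u ∈ S := by
  constructor
  · rintro ⟨v, hv, rfl⟩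
    rwa [D0.galAct_galAct]
  · intro h
    exact ⟨D0.galAct σ u, h, D0.galAct_galAct σ u⟩

/-- **Base change of angular regions** `A_K|_L` (Def. 3.1 (iv); abc-iut-L1-t6's `C0.pullRegion`):
along any arrow `f : Spec L → Spec K` of `D₀` the base change of the region of `Y` is again (the set
of) an angular region, with the same tip, whose angular part is the Galois twist of that of `Y`;
it is isotropic if `Y`'s region is. [cite: MochizukiFrdII2008, Def 3.1 (iv) p.24] -/
theorem exists_pulledRegion (Y : C0) {L : D0} (f : L ⟶ Y.base) :
    ∃ A : AngularRegion ℂ, A.carrier = C0.pullRegion Y f ∧ A.tip = Y.region.tip ∧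
      A.dir = (fun z : normOneSubgroup ℂ => unitPart ℂ (f.act (z : ℂˣ))) '' Y.region.dir ∧
      (Y.region.IsIsotropic → A.IsIsotropic) := by
  obtain ⟨σ, hσ⟩ : ∃ σ, D0.Hom.twists f = σ := ⟨_, rfl⟩
  unfold C0.pullRegion D0.Hom.act
  rw [hσ]
  cases σ
  · refine ⟨Y.region, (D0.image_galAct_false _).symm, rfl, ?_, id⟩
    have : (fun z : normOneSubgroup ℂ => unitPart ℂ (D0.galAct false (z : ℂˣ))) = id := by
      funext z
      rw [D0.galAct_false, unitPart_normOne_coe]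
      rfl
    rw [this, Set.image_id]
  · obtain ⟨A, hAd, hAt⟩ := exists_angularRegion (isOpen_inv' Y.region.isOpen_dir)
      (isConnected_inv Y.region.isConnected_dir) Y.region.tip
    refine ⟨A, ?_, hAt, ?_, ?_⟩
    · ext u
      rw [mem_image_galAct_iff, A.mem_carrier_polar_iff, AngularRegion.mem_carrier_polar_iff,
        unitPart_galAct_true, C0.absHom_galAct, hAd, hAt, Set.mem_inv]
    · rw [hAd]
      have : (fun z : normOneSubgroup ℂ => unitPart ℂ (D0.galAct true (z : ℂˣ))) =
          fun z => z⁻¹ := by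
        funext z
        rw [unitPart_galAct_true, unitPart_normOne_coe]
      rw [this, Set.image_inv_eq_inv]
    · intro hY
      show A.dir = univ
      rw [hAd, show Y.region.dir = univ from hY, Set.inv_univ]

end ArchFrd

end

end Literature.AlgebraicGeometry.Frobenioids
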